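import Summits.QuantumFields.YangMills.Theses.ConvexGribovBody
import Summits.QuantumFields.YangMills.Theses.CertificationLength
import Summits.QuantumFields.YangMills.Theses.OneCertifiedCube
import Summits.QuantumFields.YangMills.Theorems.OneCertifiedCubeFiniteSizeCriterion
import HarnessLib

/-!
# `UniformLatticeGap` (target stmt-QuantumFields-8778 of route `ConvexGribovBody`) — funnel entry from a
# Dobrushin–Shlosman finite-size condition at large `β`, and the target ⇒ crux `NonSimplyConnectedLatticeGap` link

Companion of `…NonSimplyConnectedLatticeGapCAFunnel` (crux stmt-QuantumFields-16405, line `Sketch`): the transfer there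
never uses `¬ SimplyConnectedSpace G`, so the same bookkeeping gives the route's rank-0 TARGET
`ConvexGribovBody.UniformLatticeGap` (the volume-uniform weak-coupling lattice mass gap for EVERY compact simple `G`)
from the un-restricted finite-size hypothesis:

* `uniformLatticeGap_of_cellAnalyticity_of_criterion` / `uniformLatticeGap_of_cellAnalyticity` — if for every compact
  simple `G` and faithful unitary `r` there is `β₂` such that at every `β ≥ β₂` the Wilson specification satisfies the TV
  finite-size condition of `OneCertifiedCube.FiniteSizeCriterion` at SOME admissible `(n, ε)` and SOME cell size `b ≥ 1`,
  then `UniformLatticeGap` (engine: the tree's PROVED `FiniteSizeCriterion_proof`, item 8895; `m(β) = κ(n,ε)/b`,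
  `S₁(β) = (8n+7) b`);
* `uniformLatticeGap_of_completeAnalyticityAtLargeScales` — hence item stmt-QuantumFields-16178
  (`CertificationLength.CompleteAnalyticityAtLargeScales`) implies the target (conditional result; `B = 1`, Borel
  structure rewritten by `BorelSpace.measurable_eq`);
* `nonSimplyConnectedLatticeGap_of_uniformLatticeGap` — the crux stmt-QuantumFields-16405 is the target restricted to
  `¬ SimplyConnectedSpace G` (pure logic), so ANY proof of the target closes the crux.

References: R. L. Dobrushin, S. B. Shlosman, *Constructive criterion for the uniqueness of Gibbs field* (Birkhäuser 1985),
§2; F. Martinelli, *Lectures on Glauber dynamics for discrete spin models*, LNM 1717 (1999), §2.3.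
-/

set_option autoImplicit false

noncomputable section

open MeasureTheory
open Literature.MathematicalPhysics.QuantumFieldTheory hiding Site ZdEdge
open Literature.MathematicalPhysics.QuantumLattice

namespace Summit.QuantumFields.YangMills.Theorems.NonSimplyConnectedLatticeGap

/-- **Finite-size condition at large `β` ⇒ `UniformLatticeGap`, given the criterion** (pure bookkeeping): the TV
finite-size criterion with universal threshold (`OneCertifiedCube.FiniteSizeCriterion`, item 8895) turns the
finite-size condition at `(β, b, n, ε)` into time clustering at rate `κ(n,ε)/b` on all tori of side `≥ (8n+7) b`,
`n ≤ S`, with the criterion's constant `C(A, B)`. -/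
theorem uniformLatticeGap_of_cellAnalyticity_of_criterion
    (hcrit : Summit.QuantumFields.YangMills.Theses.OneCertifiedCube.FiniteSizeCriterion)
    (hA : ∀ (G : Type) [Group G] [TopologicalSpace G] [IsTopologicalGroup G] [CompactSpace G]
      [MeasurableSpace G] [BorelSpace G], IsCompactSimpleLieGroup G →
      ∀ r : LatticeRep G, ∃ β₂ : ℝ, ∀ β : ℝ, β₂ ≤ β → ∃ (n : ℕ) (ε : ℝ) (b : ℕ), 1 ≤ n ∧ 0 ≤ ε ∧
        ε * ((((4 * n + 3) ^ 4 - (4 * n + 1) ^ 4 : ℕ)) : ℝ) < 1 ∧ 1 ≤ b ∧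
        (∀ w : Fin 4 → ℤ → ℤ, (∀ i j, w i j + ((b : ℕ) : ℤ) ≤ w i (j + 1) ∧ w i (j + 1) ≤ w i j + 2 * ((b : ℕ) : ℤ)) → ∀ Y : Finset (Fin 4 → ℤ), Y ⊆ (Fintype.piFinset fun _ : Fin 4 => Finset.Icc (-(2 * ((n : ℕ) : ℤ))) (2 * ((n : ℕ) : ℤ))) → (0 : Fin 4 → ℤ) ∈ Y → ∀ η η' : LGConfig 4 G, (∀ e ∈ (Fintype.piFinset fun _ : Fin 4 => Finset.Icc (-(2 * ((n : ℕ) : ℤ))) (2 * ((n : ℕ) : ℤ))).biUnion (fun y : Fin 4 → ℤ => (Fintype.piFinset fun i : Fin 4 => Finset.Ico (w i (y i)) (w i (y i + 1))) ×ˢ (Finset.univ : Finset (Fin 4))), η e = η' e) → ∀ f : LGConfig 4 G → ℝ, IsCylinder f ((fun y : Fin 4 → ℤ => (Fintype.piFinset fun i : Fin 4 => Finset.Ico (w i (y i)) (w i (y i + 1))) ×ˢ (Finset.univ : Finset (Fin 4))) 0) → Measurable f → (∀ U, 0 ≤ f U ∧ f U ≤ 1) → |(∫ U, f U ∂(ymSpecification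 r.ρ β (Y.biUnion (fun y : Fin 4 → ℤ => (Fintype.piFinset fun i : Fin 4 => Finset.Ico (w i (y i)) (w i (y i + 1))) ×ˢ (Finset.univ : Finset (Fin 4)))) η)) - ∫ U, f U ∂(ymSpecification r.ρ β (Y.biUnion (fun y : Fin 4 → ℤ => (Fintype.piFinset fun i : Fin 4 => Finset.Ico (w i (y i)) (w i (y i + 1))) ×ˢ (Finset.univ : Finset (Fin 4)))) η')| ≤ ε)) :
    Summit.QuantumFields.YangMills.Theses.ConvexGribovBody.UniformLatticeGap := by
  intro G _ _ _ _ _ _ hG r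
  obtain ⟨β₂, hβ₂⟩ := hA G hG r
  refine ⟨β₂, fun β hβ => ?_⟩
  obtain ⟨n, ε, b, hn, hε, hεM, hb1, hTV⟩ := hβ₂ β hβ
  obtain ⟨κ, hκ, hAll⟩ := hcrit n ε hn hε hεM
  have hb0 : (0 : ℝ) < (b : ℝ) := by exact_mod_cast hb1
  refine ⟨κ / b, div_pos hκ hb0, (8 * n + 7) * b, fun A B => ?_⟩
  obtain ⟨C, hC⟩ := hAll G r.N r.ρ r.continuous r.injective A B
  refine ⟨C, fun S t hS ht => ?_⟩
  have h2S : (8 * n + 7) * b ≤ 2 * S + 1 := by omega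
  have h := hC β b hb1 hTV S h2S t ht
  rw [div_mul_eq_mul_div]
  exact h

/-- **Finite-size condition at large `β` ⇒ `UniformLatticeGap`** (criterion discharged by the tree's
`FiniteSizeCriterion_proof`). -/
theorem uniformLatticeGap_of_cellAnalyticity
    (hA : ∀ (G : Type) [Group G] [TopologicalSpace G] [IsTopologicalGroup G] [CompactSpace G]
      [MeasurableSpace G] [BorelSpace G], IsCompactSimpleLieGroup G →
      ∀ r : LatticeRep G, ∃ β₂ : ℝ, ∀ β : ℝ, β₂ ≤ β → ∃ (n : ℕ) (ε : ℝ) (b : ℕ), 1 ≤ n ∧ 0 ≤ ε ∧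
        ε * ((((4 * n + 3) ^ 4 - (4 * n + 1) ^ 4 : ℕ)) : ℝ) < 1 ∧ 1 ≤ b ∧
        (∀ w : Fin 4 → ℤ → ℤ, (∀ i j, w i j + ((b : ℕ) : ℤ) ≤ w i (j + 1) ∧ w i (j + 1) ≤ w i j + 2 * ((b : ℕ) : ℤ)) → ∀ Y : Finset (Fin 4 → ℤ), Y ⊆ (Fintype.piFinset fun _ : Fin 4 => Finset.Icc (-(2 * ((n : ℕ) : ℤ))) (2 * ((n : ℕ) : ℤ))) → (0 : Fin 4 → ℤ) ∈ Y → ∀ η η' : LGConfig 4 G, (∀ e ∈ (Fintype.piFinset fun _ : Fin 4 => Finset.Icc (-(2 * ((n : ℕ) : ℤ))) (2 * ((n : ℕ) : ℤ))).biUnion (fun y : Fin 4 → ℤ => (Fintype.piFinset fun i : Fin 4 => Finset.Ico (w i (y i)) (w i (y i + 1))) ×ˢ (Finset.univ : Finset (Fin 4))), η e = η' e) → ∀ f : LGConfig 4 G → ℝ, IsCylinder f ((fun y : Fin 4 → ℤ => (Fintype.piFinset fun i : Fin 4 => Finset.Ico (w i (y i)) (w i (y i + 1))) ×ˢ (Finset.univ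 : Finset (Fin 4))) 0) → Measurable f → (∀ U, 0 ≤ f U ∧ f U ≤ 1) → |(∫ U, f U ∂(ymSpecification r.ρ β (Y.biUnion (fun y : Fin 4 → ℤ => (Fintype.piFinset fun i : Fin 4 => Finset.Ico (w i (y i)) (w i (y i + 1))) ×ˢ (Finset.univ : Finset (Fin 4)))) η)) - ∫ U, f U ∂(ymSpecification r.ρ β (Y.biUnion (fun y : Fin 4 → ℤ => (Fintype.piFinset fun i : Fin 4 => Finset.Ico (w i (y i)) (w i (y i + 1))) ×ˢ (Finset.univ : Finset (Fin 4)))) η')| ≤ ε)) :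
    Summit.QuantumFields.YangMills.Theses.ConvexGribovBody.UniformLatticeGap :=
  uniformLatticeGap_of_cellAnalyticity_of_criterion FiniteSizeCriterion_proof hA

/-- **Complete analyticity at large scales ⇒ the target** (attachment of item stmt-QuantumFields-16178; conditional
result for item stmt-QuantumFields-8778): `CertificationLength.CompleteAnalyticityAtLargeScales` implies
`ConvexGribovBody.UniformLatticeGap` (`B = 1`; the item fixes `borel G`, an arbitrary `[BorelSpace G]` structure is
rewritten to it by `BorelSpace.measurable_eq`). -/
theorem uniformLatticeGap_of_completeAnalyticityAtLargeScales
    (h : Summit.QuantumFields.YangMills.Theses.CertificationLength.CompleteAnalyticityAtLargeScales) :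
    Summit.QuantumFields.YangMills.Theses.ConvexGribovBody.UniformLatticeGap := by
  refine uniformLatticeGap_of_cellAnalyticity fun G _ _ _ _ iM iB hG r => ?_
  have hM : iM = borel G := BorelSpace.measurable_eq
  subst hM
  obtain ⟨n, ε, hn, hε, hεM, hB⟩ := h G hG r
  obtain ⟨β₂, hβ₂⟩ := hB 1
  refine ⟨β₂, fun β hβ => ?_⟩
  obtain ⟨b, -, hb1, hTV⟩ := hβ₂ β hβ
  exact ⟨n, ε, b, hn, hε, hεM, hb1, hTV⟩

/-- **Target ⇒ crux** (pure logic): `NonSimplyConnectedLatticeGap` (stmt-QuantumFields-16405) is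
`UniformLatticeGap` (stmt-QuantumFields-8778) restricted to `¬ SimplyConnectedSpace G`, so any proof of the target
closes the crux. -/
theorem nonSimplyConnectedLatticeGap_of_uniformLatticeGap
    (h : Summit.QuantumFields.YangMills.Theses.ConvexGribovBody.UniformLatticeGap) :
    Summit.QuantumFields.YangMills.Theses.ConvexGribovBody.NonSimplyConnectedLatticeGap :=
  fun G _ _ _ _ _ _ hG _ r => h G hG r

end Summit.QuantumFields.YangMills.Theorems.NonSimplyConnectedLatticeGap

end
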